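/-
Copyright (c) 2026 the pub-hodgecm-mathlib formalisation cell (harness21).  Prover seat hodgecm-mathlib-K2E4-p11 (g5), Track B ∕ K2-LIT, h413 =
`stmt-HodgeConjecture-24833`, line `K2_E1_TraceFormulaBeta`, campaign «EIS-RANK-ONE» ∕ R8-LADDER-2, «MS-2» — THE OPERATOR ROAD (O1)+(O3), ED. 2 in a companion file (400-line law):
the natural high-part letter `K u [g⁻¹] = R(h)ũ(g) − (R(h)ũ)_B(g)` — the form ★ (O2a)∕(O2b) `M ∘L K_Z` delivers — with NO commutation ∕ integrability letters.
-/
import Summits.HodgeConjecture.HodgeConjecture.Theorems.K2E1MaassSelbergFamilyPayerCMTwo     -- ★ p859407 (this seat): (O1)+(O3) payer, `toAutomorphicQuotient_inv_arith_mul_out_inv`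
import HarnessLib

/-!
# h413 ∕ Track B «K2-LIT», «MS-2» — `K2E1MaassSelbergFamilyPayerNaturalCMTwo`: the (O1)+(O3) payer with the NATURAL high-part letter
# `K u [g⁻¹] = R(h)ũ(g) − (R(h)ũ)_B(g)` (no `hcomm`, no `hint₁`, no `hint₂`)

Cell `pub/hodgecm-mathlib`, crux H413 = `stmt-HodgeConjecture-24833`, route `HCCMUnconditional`; dealer K2E1-plan (g6) ruling (66) ∕ (O2c) census 2026-09-04.  THEOREMS ONLY; lane
`--kind proof --supports stmt-HodgeConjecture-24833 --as helper` (count-neutral; closes no socket).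
THE MATHEMATICS [MoeglinWaldspurger1995, I.2.13; BernsteinLapid2019, §4 p. 10].  In ★ `quotFun_truncation_ae_eq_of_repr` the high-cusp letter was `Ku[g⁻¹] = ∫ h(y)(ũ − ũ_B)(g y) dνG`, which
forced the commutation `(R(h)ũ)_B = R(h)(ũ_B)` and two integrability letters at the ROUGH lift `ũ`.  But Arthur's truncation above the cut-off is `Λ^T φ = φ − φ_B` with `φ = a·R(h)ũ`
POINTWISE, so `Λ^T φ(g) = a·(R(h)ũ(g) − (R(h)ũ)_B(g))` by homogeneity of the constant term alone (★ `borelConstantTerm_smul`): with the letter in the form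
`Ku[g⁻¹] = R(h)ũ(g) − (R(h)ũ)_B(g)` — exactly what the transported high-cusp operator `M ∘L K_Z` of ★ (O2a)∕(O2b) produces ((O2c)) — the commutation and integrability letters
disappear.
* `quotFun_truncation_ae_eq_of_repr'` — (O3′) the a.e. identity with the natural high part;  `exists_family_of_operator_letters'` — the assembly without `hcomm`∕`hint₁`∕`hint₂`.
HONEST LABEL.  Count-neutral helper; proves no printed statement; `hK`, `hrepr` remain LETTERS ((O2c), (38b)); HC_CM is proved only modulo the 7 printed citations (2 remaining named inputs:
hLiu418 = `stmt-HodgeConjecture-24832`, h413 = `stmt-HodgeConjecture-24833`) until rung 0 closes.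

## References
* [MoeglinWaldspurger1995] C. Mœglin, J.-L. Waldspurger, *Spectral decomposition and Eisenstein series* (1995), I.2.13, IV.2.3.
* [BernsteinLapid2019] J. Bernstein, E. Lapid, *On the meromorphic continuation of Eisenstein series*, J. AMS 37 (2024), §4 p. 10.
* [Garrett2018] P. Garrett, *Modern analysis of automorphic forms by example* (2018), §2.10.
-/

set_option autoImplicit false
set_option linter.dupNamespace false  -- the mandated namespace repeats the summit's segment (`HodgeConjecture.HodgeConjecture`)

noncomputable section

open MeasureTheory Measure NumberField IsDedekindDomain Set Filter Topology
open scoped ENNReal NNReal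
open Literature.NumberTheory.Automorphic Literature.NumberTheory.Automorphic.UnitaryGroup AdelicGroupData
open Summit.HodgeConjecture.HodgeConjecture.Cruxes.H413.K2E1BLBorelSpacesU2Defs
open Summit.HodgeConjecture.HodgeConjecture.Cruxes.H413.K2E1BLHeckeOperatorWeightedU2 (bddAbove_range_borelHeight_arith_mul)
open Summit.HodgeConjecture.HodgeConjecture.Cruxes.H413.K2E1BLHeckeOperatorHXU2 (supHeight_toAutomorphicQuotient supHeight_pos measurable_supHeight)
open Summit.HodgeConjecture.HodgeConjecture.Cruxes.H413.K2E1BLHeckeOperatorHXU2Op (ae_withDensity_weightX_iff)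
open Summit.HodgeConjecture.HodgeConjecture.Cruxes.H413.K2E1TruncatedEisensteinL2 (truncation_apply_eq_self_of_forall_borelHeight_le)
open Summit.HodgeConjecture.HodgeConjecture.Cruxes.H413.K2E1MaassSelbergFamilyPayerCMTwo (toAutomorphicQuotient_inv_arith_mul_out_inv)

namespace Summit.HodgeConjecture.HodgeConjecture.Cruxes.H413.K2E1MaassSelbergFamilyPayerNaturalCMTwo

variable {F E : Type} [Field F] [NumberField F] [Field E] [NumberField E] [Algebra F E] {c : E ≃ₐ[F] E}
variable [MeasurableSpace (quasiSplit F E c 2).Adelic] [BorelSpace (quasiSplit F E c 2).Adelic]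

/-- **(O3′) THE a.e. IDENTITY WITH THE NATURAL HIGH PART.**  As `quotFun_truncation_ae_eq_of_repr`, but the high-cusp letter reads
`Ku [g⁻¹] = (∫ h(y)·ut(g y) dνG) − (R(h)ut)_B(g)` for `T < H(g)` — the transported `R(h)ũ − (R(h)ũ)_B` itself (what ★ (O2a)∕(O2b) `M ∘L K_Z` delivers) — so that the HIGH case is
`Λ^T φ(g) = φ(g) − φ_B(g)` with `φ = a·R(h)ut` (★ `borelConstantTerm_smul`) and NO commutation ∕ integrability letter is needed. [cite: BernsteinLapid2019, §4 p. 10]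
[cite: MoeglinWaldspurger1995, I.2.13] [cite: Garrett2018, §2.10] -/
theorem quotFun_truncation_ae_eq_of_repr' (ν : Measure (adelicUnipotent F E c 2)) [ν.IsHaarMeasure] {𝓕 : Set (adelicUnipotent F E c 2)}
    (h𝓕 : IsFundamentalDomain (rationalUnipotent F E c 2) 𝓕 ν) {T : ℝ≥0} (hT : 1 ≤ T)
    (μ : Measure (quasiSplit F E c 2).automorphicQuotient) (νG : Measure (quasiSplit F E c 2).Adelic) (h : (quasiSplit F E c 2).Adelic → ℂ)
    {φ : (quasiSplit F E c 2).Adelic → ℂ} (hφ : ∀ γ : (quasiSplit F E c 2).arithmeticSubgroup, ∀ x : (quasiSplit F E c 2).Adelic, φ ((γ : (quasiSplit F E c 2).Adelic) * x) = φ x)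
    (U : (quasiSplit F E c 2).automorphicQuotient → ℂ) {ut : (quasiSplit F E c 2).Adelic → ℂ} (hut : ∀ g, ut g = U ((quasiSplit F E c 2).toAutomorphicQuotient g⁻¹)) (a : ℂ)
    (hrepr : ∀ g, φ g = a * ∫ y, h y * ut (g * y) ∂νG)
    {Tu : (quasiSplit F E c 2).automorphicQuotient → ℂ} (hTu : Tu =ᵐ[μ] fun ξ => ∫ y, h y * U (y⁻¹ • ξ) ∂νG)
    {Ku : (quasiSplit F E c 2).automorphicQuotient → ℂ}
    (hKu : ∀ᵐ x ∂μ, (supHeight F E c 2 x ≤ T → Ku x = 0) ∧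
      ∀ g : (quasiSplit F E c 2).Adelic, (quasiSplit F E c 2).toAutomorphicQuotient g⁻¹ = x → T < borelHeight g →
        Ku x = (∫ y, h y * ut (g * y) ∂νG) - borelConstantTerm ν 𝓕 (fun x' => ∫ y, h y * ut (x' * y) ∂νG) g) :
    (quasiSplit F E c 2).quotFun (truncation ν 𝓕 T φ) =ᵐ[μ] fun x => a * ({x | supHeight F E c 2 x ≤ T}.indicator Tu x + Ku x) := by
  filter_upwards [hTu, hKu] with x hxT hxK
  set xo : (quasiSplit F E c 2).Adelic := Quotient.out (x : (quasiSplit F E c 2).Adelic ⧸ (quasiSplit F E c 2).quotientSubgroup) with hxodef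
  have hx : (quasiSplit F E c 2).toAutomorphicQuotient xo = x := QuotientGroup.out_eq' _
  have hsup : supHeight F E c 2 x = ⨆ γ : (quasiSplit F E c 2).arithmeticSubgroup, borelHeight ((γ : (quasiSplit F E c 2).Adelic) * xo⁻¹) := by
    conv_lhs => rw [← hx]
    exact supHeight_toAutomorphicQuotient xo
  have hq : (quasiSplit F E c 2).quotFun (truncation ν 𝓕 T φ) x = truncation ν 𝓕 T φ xo⁻¹ := rfl
  by_cases hle : supHeight F E c 2 x ≤ T
  · -- LOW (verbatim as in §3)
    have hall : ∀ δ : (quasiSplit F E c 2).arithmeticSubgroup, borelHeight ((δ : (quasiSplit F E c 2).Adelic) * xo⁻¹) ≤ T := fun δ =>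
      (le_ciSup (bddAbove_range_borelHeight_arith_mul xo⁻¹) δ).trans (hsup ▸ hle)
    rw [hq, truncation_apply_eq_self_of_forall_borelHeight_le ν 𝓕 φ hall, hrepr, Set.indicator_of_mem (show x ∈ {x | supHeight F E c 2 x ≤ T} from hle), (hxK.1 hle), add_zero, hxT]
    congr 1
    refine integral_congr_ae (Eventually.of_forall fun y => ?_)
    show h y * ut (xo⁻¹ * y) = h y * U (y⁻¹ • x)
    rw [hut, _root_.mul_inv_rev, inv_inv]
    congr 2
    rw [← hx]
    rfl
  · -- HIGH: `Λ^T φ(g) = φ(g) − φ_B(g) = a·(R(h)ut(g) − (R(h)ut)_B(g)) = a·Ku x`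
    have hlt : T < supHeight F E c 2 x := not_le.1 hle
    rw [hsup] at hlt
    obtain ⟨δ, hδ⟩ := exists_lt_of_lt_ciSup hlt
    set g : (quasiSplit F E c 2).Adelic := (δ : (quasiSplit F E c 2).Adelic) * xo⁻¹ with hgdef
    have hgx : (quasiSplit F E c 2).toAutomorphicQuotient g⁻¹ = x := toAutomorphicQuotient_inv_arith_mul_out_inv x δ
    have hinv : truncation ν 𝓕 T φ xo⁻¹ = truncation ν 𝓕 T φ g := by
      have h1 : xo⁻¹ = ((δ⁻¹ : (quasiSplit F E c 2).arithmeticSubgroup) : (quasiSplit F E c 2).Adelic) * g := by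
        rw [hgdef, Subgroup.coe_inv, inv_mul_cancel_left]
      rw [h1, truncation_rational_mul ν h𝓕 T hφ]
    have hφfun : φ = a • fun x => ∫ y, h y * ut (x * y) ∂νG := by
      funext g'; rw [Pi.smul_apply, smul_eq_mul]; exact hrepr g'
    have hB : borelConstantTerm ν 𝓕 φ g = a * borelConstantTerm ν 𝓕 (fun x' => ∫ y, h y * ut (x' * y) ∂νG) g := by
      rw [hφfun, borelConstantTerm_smul]
    rw [hq, hinv, truncation_eq_self_sub_borelConstantTerm_of_rational_invariant_two ν h𝓕 hφ hT hδ, hB, hrepr g,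
      Set.indicator_of_notMem (show x ∉ {x | supHeight F E c 2 x ≤ T} from hle), zero_add, hxK.2 g hgx hδ, ← mul_sub]

/-- **ASSEMBLY WITH THE NATURAL HIGH PART** (the form (O2c) `exists_highPartOperator` pays): as `exists_family_of_operator_letters` with the high-cusp operator letter
`hK' : K u [g⁻¹] = R(h)ũ(g) − (R(h)ũ)_B(g)` a.e. above the cut-off and `K u = 0` a.e. below it — and WITHOUT the letters `hcomm`, `hint₁`, `hint₂`.  THEN
`F z := ĥ(z)⁻¹ • (A_T (T_X (vX z)) + K (vX z))` is holomorphic on `D` with `F z =ᵐ[μ] quotFun (Λ^T (Ec z))`. [cite: BernsteinLapid2019, §4 p. 10] [cite: MoeglinWaldspurger1995, IV.2.3] -/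
theorem exists_family_of_operator_letters' (ν : Measure (adelicUnipotent F E c 2)) [ν.IsHaarMeasure] {𝓕 : Set (adelicUnipotent F E c 2)}
    (h𝓕 : IsFundamentalDomain (rationalUnipotent F E c 2) 𝓕 ν) {T : ℝ≥0} (hT : 1 ≤ T) (k : ℕ)
    (μ : Measure (quasiSplit F E c 2).automorphicQuotient) (νG : Measure (quasiSplit F E c 2).Adelic) (h : (quasiSplit F E c 2).Adelic → ℂ)
    {D : Set ℂ} (vX : ℂ → HX F E c 2 k μ) (hvX : DifferentiableOn ℂ vX D)
    (ĥ : ℂ → ℂ) (hĥ : DifferentiableOn ℂ ĥ D) (hĥ0 : ∀ z ∈ D, ĥ z ≠ 0)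
    (Ec : ℂ → (quasiSplit F E c 2).Adelic → ℂ)
    (hEcinv : ∀ z ∈ D, ∀ γ : (quasiSplit F E c 2).arithmeticSubgroup, ∀ x : (quasiSplit F E c 2).Adelic, Ec z ((γ : (quasiSplit F E c 2).Adelic) * x) = Ec z x)
    (hrepr : ∀ z ∈ D, ∀ g : (quasiSplit F E c 2).Adelic,
      Ec z g = (ĥ z)⁻¹ * ∫ y, h y * ((vX z : HX F E c 2 k μ) : (quasiSplit F E c 2).automorphicQuotient → ℂ) ((quasiSplit F E c 2).toAutomorphicQuotient (g * y)⁻¹) ∂νG)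
    (TX : HX F E c 2 k μ →L[ℂ] HX F E c 2 k μ)
    (hTX : ∀ u : HX F E c 2 k μ, ((TX u : HX F E c 2 k μ) : (quasiSplit F E c 2).automorphicQuotient → ℂ)
      =ᵐ[μ.withDensity fun x => (((supHeight F E c 2 x)⁻¹ ^ (2 * k) : ℝ≥0) : ℝ≥0∞)]
        fun ξ => ∫ y, h y * (u : (quasiSplit F E c 2).automorphicQuotient → ℂ) (y⁻¹ • ξ) ∂νG)
    (A : HX F E c 2 k μ →L[ℂ] Lp ℂ 2 μ)
    (hA : ∀ u : HX F E c 2 k μ, ((A u : Lp ℂ 2 μ) : (quasiSplit F E c 2).automorphicQuotient → ℂ) =ᵐ[μ]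
      {x | supHeight F E c 2 x ≤ T}.indicator (u : (quasiSplit F E c 2).automorphicQuotient → ℂ))
    (K : HX F E c 2 k μ →L[ℂ] Lp ℂ 2 μ)
    (hK : ∀ u : HX F E c 2 k μ, ∀ᵐ x ∂μ, (supHeight F E c 2 x ≤ T → ((K u : Lp ℂ 2 μ) : (quasiSplit F E c 2).automorphicQuotient → ℂ) x = 0) ∧
      ∀ g : (quasiSplit F E c 2).Adelic, (quasiSplit F E c 2).toAutomorphicQuotient g⁻¹ = x → T < borelHeight g →
        ((K u : Lp ℂ 2 μ) : (quasiSplit F E c 2).automorphicQuotient → ℂ) x =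
          (∫ y, h y * (u : (quasiSplit F E c 2).automorphicQuotient → ℂ) ((quasiSplit F E c 2).toAutomorphicQuotient (g * y)⁻¹) ∂νG) -
            borelConstantTerm ν 𝓕 (fun x' => ∫ y, h y * (u : (quasiSplit F E c 2).automorphicQuotient → ℂ) ((quasiSplit F E c 2).toAutomorphicQuotient (x' * y)⁻¹) ∂νG) g) :
    ∃ Fam : ℂ → Lp ℂ 2 μ, DifferentiableOn ℂ Fam D ∧
      ∀ z ∈ D, ((Fam z : Lp ℂ 2 μ) : (quasiSplit F E c 2).automorphicQuotient → ℂ) =ᵐ[μ] (quasiSplit F E c 2).quotFun (truncation ν 𝓕 T (Ec z)) := by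
  refine ⟨fun z => (ĥ z)⁻¹ • ((A.comp TX + K) (vX z)), (hĥ.inv hĥ0).smul ((A.comp TX + K).differentiable.comp_differentiableOn hvX), fun z hz => ?_⟩
  have h3 := quotFun_truncation_ae_eq_of_repr' ν h𝓕 hT μ νG h (hEcinv z hz) ((vX z : HX F E c 2 k μ) : (quasiSplit F E c 2).automorphicQuotient → ℂ)
    (ut := fun g => ((vX z : HX F E c 2 k μ) : (quasiSplit F E c 2).automorphicQuotient → ℂ) ((quasiSplit F E c 2).toAutomorphicQuotient g⁻¹)) (fun _ => rfl) (ĥ z)⁻¹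
    (hrepr z hz) ((ae_withDensity_weightX_iff μ k).1 (hTX (vX z))) (hK (vX z))
  have hsm := Lp.coeFn_smul (ĥ z)⁻¹ ((A.comp TX + K) (vX z))
  have hadd := Lp.coeFn_add (A (TX (vX z))) (K (vX z))
  filter_upwards [h3, hsm, hadd, hA (TX (vX z))] with x hx hxs hxa hxA
  rw [hx, hxs, Pi.smul_apply, smul_eq_mul, FunLike.coe_add, Pi.add_apply, ContinuousLinearMap.comp_apply, hxa, Pi.add_apply, hxA]

end Summit.HodgeConjecture.HodgeConjecture.Cruxes.H413.K2E1MaassSelbergFamilyPayerNaturalCMTwo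

end
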